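import Mathlib
import Literature.NumberTheory.Sieve.Maynard2016GPYWeights
import Literature.NumberTheory.Sieve.Maynard2016Theorem1OfGPY
import HarnessLib

/-!
# Maynard 2016, §8 (final paragraph), PROVED: `Lemma7 → Lemma8 → GPYMeasures`

Topic `Literature/NumberTheory/Sieve`. J. Maynard, *Large gaps between primes*, Ann. of Math. (2)
183 (2016), 915–933 = arXiv:1408.5110, §8, last paragraph (p. 13):

> "Lemma 8 gives (together with Lemma 7) `Σ_{q ∈ 𝓘_m} μ_{m,q}(p₀) ≫ (1 + o_k(1)) δ log k` for all
> `p₀ ∈ 𝓡_m` with `h_k x < p₀ < U/m − h_k x`. Recalling that `h_k x = o(x log₂ x)` and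
> `m < U z⁻¹ (log₂ x)⁻²`, by Lemma 3 the number of primes in `𝓡_m` not satisfying this bound is
> `o(|𝓡_m|)`. Thus, given any `t, δ > 0` we can choose `k` sufficiently large in terms of `δ` and
> `t` so that the right hand side is at least `t` for sufficiently large `x`. [...] This completes
> the proof of Proposition 5, and hence Theorem 1."

This file proves exactly that deduction, in the tree's typing:

* `gpyMeasures_of_lemma7_lemma8 : Lemma7 → Lemma8 → GPYMeasures` (`Lemma7`, `Lemma8` the named
  facts of `Maynard2016GPYWeights`; `GPYMeasures` the named fact of `Maynard2016GPYReduction`),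
  using the PROVED `lemma3_holds : Lemma3` (`Maynard2016Lemma3Proof`) for the two end ranges;
* hence `theorem1_of_lemma7_lemma8 : Lemma7 → Lemma8 → Maynard2016_theorem1` and
  `forall_rankinConstant_of_lemma7_lemma8 : Lemma7 → Lemma8 → ∀ c, RankinConstant c`
  (via `theorem1_of_GPYMeasures_holds`, `forall_rankinConstant_of_GPYMeasures_holds`).

After this file the kernel-checked chain for Maynard's Theorem 1 has exactly two named inputs,
`Lemma7` (§6, the lower bound for `Σ_q μ_{m,q}(p₀)`) and `Lemma8` (§8, the choice of smooth data
with `k J J / (I I) ≫ log k`); `Lemma6` (the asymptotic for `α_{m,q}⁻¹`) is an input of Lemma 7's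
proof only.

## The proof (§8, last paragraph, made quantitative)

Fix `C_U > 0`; Lemma 7 supplies, for a.e. small `ε`, a constant `c > 0`; Lemma 3 supplies `K`.
Given `δ, η > 0` and `t`, choose `k ≥ max(k₀, 2)` with `c c₈ δ log k ≥ 2 (|t| + 1)` (`c₈, k₀`
from Lemma 8) and the data `(J, c_j, F, G)` of Lemma 8 for this `k`. The measures are the
`μ_{m,q}` of (4.1) for these data — replaced by the uniform measure on `ℤ/qℤ` for the (in fact
non-occurring) primes `q` with `α_{m,q}⁻¹ = 0`, which keeps every `μ_q` a probability measure and
only increases `Σ_q μ_q(p₀)`. For `p₀` in the middle range Lemma 7 (with `κ = 1/2`), the length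
bound `|𝓘_m| ≥ δ |𝓡_m| log x` and Lemma 8 give `Σ_q μ_q(p₀) ≥ (c/2) c₈ δ log k > t`
(`middle_numeric`). The exceptional `p₀` therefore lie in `[0, H x]` or `[U/m − H x, U/m]`,
`H := Σ_i h_i = (Σ_{i<k} p_{π(k)+i+1}) P_w ≤ A_k (log₃ x)³` (`P_w ≤ 4^w`, `w = log₄ x`), while
`U/m > z (log₂ x)² = x log₂ x`; Lemma 3 at `V = H x`, `V = U/m` and `V = U/m − H x − 1`
(all in `[z + z/log x, x (log x)²]`, and `m ≤ x`) with relative error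
`K e^{−√(log₂ x)} ≤ min(η/8, 1/2)` bounds the two end counts by `η |𝓡_m|` (`endRange_numeric`,
using `3 H x + 1 ≤ (η/4)(U/m − z)`, i.e. `64 H ≤ η log₂ x`, which holds for large `x` since
`H ≤ A_k (log₃ x)³`).

## References

* J. Maynard, *Large gaps between primes*, Ann. of Math. (2) 183 (2016), 915–933; arXiv:1408.5110,
  §8 (final paragraph), Lemma 3, Lemma 7, Lemma 8, display (4.1). [Maynard2016LargeGaps]
-/

open Filter Finset MeasureTheory
open scoped Topology

namespace Literature.NumberTheory.Sieve

namespace Maynard2016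

/-! ### §8 (last paragraph): `Lemma7 → Lemma8 → GPYMeasures` -/

/-- The crude bound `H = Σ_i h_i` for the elements of the tuple (used only for the two end ranges
`p₀ ≤ h_k x`, `p₀ ≥ U/m − h_k x` of Lemma 7). [cite: Maynard2016LargeGaps, §8 (final paragraph)] -/
noncomputable def hSum (k x : ℕ) : ℕ := ∑ i : Fin k, hTuple k x i

/-- `h_i ≤ H`. [cite: Maynard2016LargeGaps, §8 (final paragraph)] -/
theorem hTuple_le_hSum (k x : ℕ) (i : Fin k) : hTuple k x i ≤ hSum k x :=
  Finset.single_le_sum (f := fun j => hTuple k x j) (fun _ _ => Nat.zero_le _) (Finset.mem_univ i)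

/-- `H = (Σ_i p_{π(k)+i+1}) · P_w`. [cite: Maynard2016LargeGaps, §4 (definition of h_j)] -/
theorem hSum_eq (k x : ℕ) :
    hSum k x = (∑ i : Fin k, Nat.nth Nat.Prime (Nat.primeCounting k + i)) * Pw x := by
  unfold hSum hTuple
  rw [Finset.sum_mul]

/-- `1 ≤ H` for `k ≥ 1`. [cite: Maynard2016LargeGaps, §4 (definition of h_j)] -/
theorem one_le_hSum {k : ℕ} (hk : 1 ≤ k) (x : ℕ) : 1 ≤ hSum k x := by
  have h0 : hTuple k x ⟨0, hk⟩ ≤ hSum k x := hTuple_le_hSum k x ⟨0, hk⟩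
  have h1 : 1 ≤ hTuple k x ⟨0, hk⟩ := by
    unfold hTuple Pw
    exact Nat.one_le_iff_ne_zero.2 (Nat.mul_ne_zero (Nat.prime_nth_prime _).ne_zero
      (primorial_pos _).ne')
  exact h1.trans h0

/-- `P_w ≤ (log₃ x)³` once `log₃ x ≥ 1` (`P_w ≤ 4^w`, `w = log₄ x`, `log 4 ≤ 3`). [folklore] -/
private theorem Pw_le {x : ℕ} (hL₃ : 1 ≤ Real.log (Real.log (Real.log x))) :
    (Pw x : ℝ) ≤ (Real.log (Real.log (Real.log x))) ^ 3 := by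
  set L₃ := Real.log (Real.log (Real.log x)) with hL₃def
  have hL₃0 : 0 < L₃ := by linarith
  have hw0 : 0 ≤ wFun x := by
    unfold wFun; rw [← hL₃def]; exact Real.log_nonneg hL₃
  have h1 : (Pw x : ℝ) ≤ (4 : ℝ) ^ (⌊wFun x⌋₊ : ℝ) := by
    rw [Real.rpow_natCast]
    unfold Pw
    exact_mod_cast primorial_le_four_pow _
  have h2 : (4 : ℝ) ^ (⌊wFun x⌋₊ : ℝ) ≤ (4 : ℝ) ^ (wFun x) :=
    Real.rpow_le_rpow_of_exponent_le (by norm_num) (Nat.floor_le hw0)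
  have h3 : (4 : ℝ) ^ (wFun x) ≤ Real.exp (3 * wFun x) := by
    rw [Real.rpow_def_of_pos (by norm_num : (0 : ℝ) < 4)]
    apply Real.exp_le_exp.2
    have h4 : Real.log 4 ≤ 3 := by
      have := Real.log_le_sub_one_of_pos (show (0 : ℝ) < 4 by norm_num); linarith
    nlinarith
  have h4 : Real.exp (3 * wFun x) = L₃ ^ 3 := by
    unfold wFun; rw [← hL₃def, ← Real.exp_log hL₃0]
    rw [Real.log_exp, ← Real.exp_nat_mul]; norm_num
  linarith [h4.le]

/-- Growth facts in `x` used by the assembly. [folklore] -/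
private theorem eventually_growth (C_U A c₁ c₂ : ℝ) :
    ∀ᶠ X : ℝ in atTop,
      4 ≤ Real.log X ∧ 2 ≤ Real.log (Real.log X) ∧ 1 ≤ Real.log (Real.log (Real.log X)) ∧
      Real.log (Real.log (Real.log X)) ≤ Real.log (Real.log X) ∧
      C_U ≤ Real.log X ∧ C_U * Real.log X ≤ X ∧
      A * Real.log (Real.log (Real.log X)) ^ 3 ≤ Real.log (Real.log X) ∧
      c₁ ^ 2 ≤ Real.log (Real.log X) ∧ c₂ ^ 2 ≤ Real.log (Real.log X) := by
  have hT₁ : Tendsto (fun X : ℝ => Real.log X) atTop atTop := Real.tendsto_log_atTop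
  have hT₂ : Tendsto (fun X : ℝ => Real.log (Real.log X)) atTop atTop :=
    Real.tendsto_log_atTop.comp hT₁
  have hT₃ : Tendsto (fun X : ℝ => Real.log (Real.log (Real.log X))) atTop atTop :=
    Real.tendsto_log_atTop.comp hT₂
  have hδ : (0 : ℝ) < 1 / (|A| + 1) := by positivity
  -- `log u ≤ (u^{1/3}) / (|A|+1)^{1/3}` eventually, in the form `(|A|+1) (log u)^3 ≤ u`
  have hlin₃ := hT₂.eventually
    ((isLittleO_log_rpow_atTop (show (0 : ℝ) < 1 / 3 by norm_num)).bound
      (show (0 : ℝ) < 1 / (|A| + 1) by positivity))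
  have hlin₁ := Real.isLittleO_log_id_atTop.bound (show (0 : ℝ) < 1 / (|C_U| + 1) by positivity)
  filter_upwards [hT₁.eventually_ge_atTop 4, hT₂.eventually_ge_atTop 2,
    hT₃.eventually_ge_atTop 1, hT₁.eventually_ge_atTop C_U, hT₂.eventually_ge_atTop (c₁ ^ 2),
    hT₂.eventually_ge_atTop (c₂ ^ 2), hlin₃, hlin₁, eventually_ge_atTop (0 : ℝ),
    hT₂.eventually (Real.isLittleO_log_id_atTop.bound (show (0 : ℝ) < 1 by norm_num))]
    with X hL hL₂ hL₃ hCU hc₁ hc₂ h₃ h₁ hX0 h₃₂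
  have hL0 : 0 < Real.log X := by linarith
  have hL₂0 : 0 < Real.log (Real.log X) := by linarith
  have hL₃0 : 0 < Real.log (Real.log (Real.log X)) := by linarith
  rw [Real.norm_eq_abs, Real.norm_eq_abs, abs_of_nonneg hL₃0.le,
    abs_of_nonneg (Real.rpow_nonneg hL₂0.le _)] at h₃
  rw [Real.norm_eq_abs, Real.norm_eq_abs, id, abs_of_nonneg hL0.le, abs_of_nonneg hX0] at h₁
  rw [Real.norm_eq_abs, Real.norm_eq_abs, id, abs_of_nonneg hL₃0.le, abs_of_nonneg hL₂0.le,
    one_mul] at h₃₂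
  refine ⟨hL, hL₂, hL₃, h₃₂, hCU, ?_, ?_, hc₁, hc₂⟩
  · -- `C_U log X ≤ X`
    have h2 : (|C_U| + 1) * Real.log X ≤ X := by
      have h := mul_le_mul_of_nonneg_left h₁ (by positivity : (0 : ℝ) ≤ |C_U| + 1)
      have : (|C_U| + 1) * (1 / (|C_U| + 1) * X) = X := by field_simp
      linarith
    have h3 : C_U * Real.log X ≤ (|C_U| + 1) * Real.log X :=
      mul_le_mul_of_nonneg_right (by linarith [le_abs_self C_U]) hL0.le
    linarith
  · -- `A L₃³ ≤ L₂` from `L₃ ≤ L₂^{1/3}/(|A|+1)`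
    set u := Real.log (Real.log X) with hu
    set v := Real.log (Real.log (Real.log X)) with hv
    have hv3 : v ^ 3 ≤ (1 / (|A| + 1)) ^ 3 * u := by
      have h4 : v ^ 3 ≤ (1 / (|A| + 1) * u ^ ((1 : ℝ) / 3)) ^ 3 :=
        pow_le_pow_left₀ hL₃0.le h₃ 3
      have h5 : (u ^ ((1 : ℝ) / 3)) ^ 3 = u := by
        rw [← Real.rpow_natCast, ← Real.rpow_mul hL₂0.le]; norm_num
      calc v ^ 3 ≤ (1 / (|A| + 1) * u ^ ((1 : ℝ) / 3)) ^ 3 := h4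
        _ = (1 / (|A| + 1)) ^ 3 * (u ^ ((1 : ℝ) / 3)) ^ 3 := by ring
        _ = (1 / (|A| + 1)) ^ 3 * u := by rw [h5]
    have hA1 : 1 ≤ |A| + 1 := by linarith [abs_nonneg A]
    have h6 : (1 / (|A| + 1)) ^ 3 ≤ 1 / (|A| + 1) := by
      have h7 : 0 ≤ 1 / (|A| + 1) := by positivity
      have h8 : 1 / (|A| + 1) ≤ 1 := by
        rw [div_le_one (by positivity)]; exact hA1
      calc (1 / (|A| + 1)) ^ 3 ≤ (1 / (|A| + 1)) ^ 1 := pow_le_pow_of_le_one h7 h8 (by norm_num)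
        _ = 1 / (|A| + 1) := pow_one _
    have h9 : v ^ 3 ≤ 1 / (|A| + 1) * u := by nlinarith
    have h10 : (|A| + 1) * v ^ 3 ≤ u := by
      have h := mul_le_mul_of_nonneg_left h9 (by positivity : (0 : ℝ) ≤ |A| + 1)
      have : (|A| + 1) * (1 / (|A| + 1) * u) = u := by field_simp
      linarith
    have h11 : A * v ^ 3 ≤ (|A| + 1) * v ^ 3 :=
      mul_le_mul_of_nonneg_right (by linarith [le_abs_self A]) (pow_nonneg hL₃0.le 3)
    linarith

/-- The numerical core of the end-range count: with `W = 𝔖/log x ≥ 0`, `a = U/m − z ≥ 0`,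
`b = H x ≥ 0`, `0 ≤ Ke ≤ 1/2`, `2 Ke ≤ η/4`, `3 b + 1 ≤ (η/4) a`, the Lemma-3 bounds
`cH ≤ (1 + Ke)(b − z) W`, `cR ≤ (1 + Ke) a W`, `(1 − Ke) a W ≤ cR`, `(1 − Ke)(a − b − 1) W ≤ cV`
give `cH + (cR − cV) ≤ η cR`. [folklore] -/
private theorem endRange_numeric {W a b zr Ke η cH cR cV : ℝ} (hW : 0 ≤ W) (ha : 0 ≤ a)
    (hb : 0 ≤ b) (hz : 0 ≤ zr) (hKe0 : 0 ≤ Ke) (hKe1 : Ke ≤ 1 / 2) (hKeη : 2 * Ke ≤ η / 4)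
    (hη : 0 < η) (hba : 3 * b + 1 ≤ η / 4 * a)
    (hcH : cH ≤ (1 + Ke) * ((b - zr) * W)) (hcRu : cR ≤ (1 + Ke) * (a * W))
    (hcRl : (1 - Ke) * (a * W) ≤ cR) (hcV : (1 - Ke) * ((a - b - 1) * W) ≤ cV) :
    cH + (cR - cV) ≤ η * cR := by
  have hKW : 0 ≤ Ke * W := mul_nonneg hKe0 hW
  have h1 : cH + (cR - cV) ≤ (2 * b + 1) * W + 2 * Ke * (a * W) := by
    nlinarith [mul_nonneg hKW hz, mul_nonneg hKW hb, mul_nonneg hW hz, mul_nonneg hKW ha]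
  have h2 : (2 * b + 1) * W ≤ η / 4 * a * W := by
    apply mul_le_mul_of_nonneg_right _ hW; linarith
  have h3 : 2 * Ke * (a * W) ≤ η / 4 * a * W := by
    have := mul_le_mul_of_nonneg_right hKeη (mul_nonneg ha hW)
    linarith [this]
  have h4 : η / 2 * a * W ≤ η * ((1 - Ke) * (a * W)) := by
    have h5 : (1 : ℝ) / 2 ≤ 1 - Ke := by linarith
    have h6 : 1 / 2 * (a * W) ≤ (1 - Ke) * (a * W) :=
      mul_le_mul_of_nonneg_right h5 (mul_nonneg ha hW)
    nlinarith [h6, hη.le]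
  have h7 : η * ((1 - Ke) * (a * W)) ≤ η * cR := mul_le_mul_of_nonneg_left hcRl hη.le
  linarith

/-- The numerical core of the middle range: `(1 − 1/2) c (B − A) (ΣJ) J₂ / (L |𝓡| I₁ I₂) ≥ t` once
`B − A ≥ δ |𝓡| L`, `(ΣJ) J₂ ≥ c₈ (log k) I₁ I₂` and `c c₈ δ log k ≥ 2(|t| + 1)`. [folklore] -/
private theorem middle_numeric {c c₈ δ lk t BA SJ J₂ L R I₁ I₂ : ℝ} (hc : 0 < c) (hc₈ : 0 ≤ c₈)
    (hlk : 0 ≤ lk) (hδ : 0 < δ) (hL : 0 < L) (hR : 0 < R) (hI₁ : 0 < I₁) (hI₂ : 0 < I₂)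
    (hBA : δ * R * L ≤ BA) (hJ : c₈ * lk * (I₁ * I₂) ≤ SJ * J₂)
    (hk : 2 * (|t| + 1) ≤ c * c₈ * δ * lk) :
    t < (1 - 1 / 2) * c * (BA * SJ * J₂) / (L * R * I₁ * I₂) := by
  have hD : 0 < L * R * I₁ * I₂ := by positivity
  rw [lt_div_iff₀ hD]
  have h1 : δ * R * L * (c₈ * lk * (I₁ * I₂)) ≤ BA * (SJ * J₂) :=
    mul_le_mul hBA hJ (by positivity) (le_trans (by positivity) hBA)
  have h2 : t ≤ |t| := le_abs_self t
  nlinarith [mul_pos hL hR, mul_pos hI₁ hI₂, mul_pos (mul_pos hL hR) (mul_pos hI₁ hI₂), h1, hc]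

/-- **Maynard 2016, §8 (final paragraph), PROVED from Lemmas 7 and 8 (named facts of this file)
and Lemma 3 (`lemma3_holds`)**: the GPY measures `μ_{m,q}` of (4.1), built on the data of Lemma 8
with `k` large in terms of `δ` and `t`, satisfy `Σ_{q ∈ 𝓘_m} μ_{m,q}(p₀) ≥ t` for every
`p₀ ∈ 𝓡_m` with `H x < p₀ < U/m − H x` (Lemma 7), and the two end ranges contain at most
`η |𝓡_m|` elements of `𝓡_m` by Lemma 3 (since `H x = o(x log₂ x)` while `U/m > z (log₂ x)² = x log₂ x`).
For primes `q` whose normalising sum vanishes the uniform measure is used instead (it only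
increases `Σ_q μ_q(p₀)`). [cite: Maynard2016LargeGaps, §8 (final paragraph)] -/
theorem gpyMeasures_of_lemma7_lemma8 (h7 : Lemma7) (h8 : Lemma8) : GPYMeasures := by
  classical
  intro C_U hC
  obtain ⟨c₈, hc₈, k₀, hk₀⟩ := h8
  have h3 := lemma3_holds
  have hεI : ∀ᶠ ε : ℝ in 𝓝[>] 0, 0 < ε ∧ ε < 1 / 2 := by
    filter_upwards [eventually_nhdsWithin_of_forall (s := Set.Ioi (0 : ℝ)) (fun ε hε => hε),
      (eventually_lt_nhds (show (0 : ℝ) < 1 / 2 by norm_num)).filter_mono nhdsWithin_le_nhds]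
      with ε h1 h2
    exact ⟨h1, h2⟩
  filter_upwards [h7 C_U hC, h3, hεI] with ε h7ε h3ε hεb
  obtain ⟨c, hc, h7k⟩ := h7ε
  obtain ⟨K, hK, h3x⟩ := h3ε
  intro δ hδ η hη t
  -- choice of `k`: `k ≥ k₀`, `k ≥ 2`, `c c₈ δ log k ≥ 2(|t|+1)`
  obtain ⟨k, hkk₀, hk2, hklog⟩ : ∃ k : ℕ, k₀ ≤ k ∧ 2 ≤ k ∧
      2 * (|t| + 1) ≤ c * c₈ * δ * Real.log k := by
    have hpos : 0 < c * c₈ * δ := by positivity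
    refine ⟨max k₀ (max 2 ⌈Real.exp (2 * (|t| + 1) / (c * c₈ * δ))⌉₊), le_max_left _ _,
      (le_max_left _ _).trans (le_max_right _ _), ?_⟩
    have h1 : Real.exp (2 * (|t| + 1) / (c * c₈ * δ)) ≤
        ((max k₀ (max 2 ⌈Real.exp (2 * (|t| + 1) / (c * c₈ * δ))⌉₊) : ℕ) : ℝ) := by
      calc Real.exp (2 * (|t| + 1) / (c * c₈ * δ))
          ≤ ⌈Real.exp (2 * (|t| + 1) / (c * c₈ * δ))⌉₊ := Nat.le_ceil _
        _ ≤ ((max k₀ (max 2 ⌈Real.exp (2 * (|t| + 1) / (c * c₈ * δ))⌉₊) : ℕ) : ℝ) := by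
          exact_mod_cast (le_max_right _ _).trans (le_max_right _ _)
    have h2 := Real.log_le_log (Real.exp_pos _) h1
    rw [Real.log_exp] at h2
    have h3 : c * c₈ * δ * (2 * (|t| + 1) / (c * c₈ * δ)) = 2 * (|t| + 1) := by field_simp
    have h4 := mul_le_mul_of_nonneg_left h2 hpos.le
    linarith
  obtain ⟨J, cj, Fd, G, hD, hI1, hI2, hJ⟩ := hk₀ k hkk₀
  have h7x := h7k k hk2 J cj Fd G hD hI1 hI2 δ hδ (1 / 2) (by norm_num)
  -- growth facts
  have hgrowth := tendsto_natCast_atTop_atTop.eventually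
    (eventually_growth C_U ((64 / η + 8) *
      ((∑ i : Fin k, Nat.nth Nat.Prime (Nat.primeCounting k + i) : ℕ) : ℝ))
      (Real.log (η / (8 * K))) (Real.log (1 / (2 * K))))
  filter_upwards [h7x, h3x, hgrowth, eventually_ge_atTop 1] with x h7 h3 hg hx1
  obtain ⟨hL, hL₂, hL₃, hL₃₂, hCU, hCUL, hAL, hc₁, hc₂⟩ := hg
  intro m hm1 hmev hmU A' B hA' hB hlen
  have hL0 : 0 < Real.log x := by linarith
  have hL₂0 : 0 < Real.log (Real.log x) := by linarith
  have hx0 : (0 : ℝ) < x := by exact_mod_cast hx1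
  have hx1' : (1 : ℝ) ≤ x := by exact_mod_cast hx1
  have hm0 : (0 : ℝ) < m := by exact_mod_cast hm1
  -- the measures, with the uniform fallback for a vanishing normalising sum
  refine ⟨fun q a => if normInv cj Fd G C_U ε x m q = 0 then 1 / (q : ℝ)
      else gpyMeasure cj Fd G C_U ε x m q a, ?_, ?_, ?_⟩
  · intro q _ a _
    dsimp only
    by_cases hq : normInv cj Fd G C_U ε x m q = 0
    · rw [if_pos hq]; positivity
    · rw [if_neg hq]; exact gpyMeasure_nonneg cj Fd G C_U ε x m q a
  · intro q hq
    dsimp only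
    have hB0 : 0 ≤ B := by
      have h0 : (0 : ℝ) ≤ δ * (Rm C_U ε x m).card * Real.log x := by positivity
      linarith only [h0, hlen, hA', hx0]
    have hqP : q.Prime := ((mem_intervalPrimes hB0).1 hq).1
    by_cases hq0 : normInv cj Fd G C_U ε x m q = 0
    · simp only [if_pos hq0, Finset.sum_const, Finset.card_range, nsmul_eq_mul]
      rw [mul_one_div, div_self]
      exact_mod_cast hqP.ne_zero
    · simp only [if_neg hq0]
      exact sum_gpyMeasure_range cj Fd G C_U ε x m hqP.pos hq0
  · dsimp only
    -- (1) the middle range: Lemma 7 + Lemma 8 give `Σ_q μ_q(p₀) ≥ t`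
    have hgood : ∀ p₀ ∈ Rm C_U ε x m, (∀ i : Fin k, (hTuple k x i : ℝ) * x < p₀ ∧
        (p₀ : ℝ) < U C_U ε x / m - hTuple k x i * x) →
        t ≤ ∑ q ∈ intervalPrimes A' B,
          (if normInv cj Fd G C_U ε x m q = 0 then 1 / (q : ℝ)
            else gpyMeasure cj Fd G C_U ε x m q (p₀ % q)) := by
      intro p₀ hp₀ hends
      have hRpos : (0 : ℝ) < (Rm C_U ε x m).card := by
        exact_mod_cast Finset.card_pos.2 ⟨p₀, hp₀⟩
      have hmid := h7 m hm1 hmev hmU A' B hA' hB hlen p₀ hp₀ hends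
      have hlogk : 0 ≤ Real.log k := Real.log_natCast_nonneg k
      have hnum := middle_numeric (t := t) hc hc₈.le hlogk hδ hL0 hRpos hI1 hI2 hlen hJ hklog
      refine le_trans (le_of_lt (lt_of_lt_of_le hnum hmid)) (Finset.sum_le_sum fun q _ => ?_)
      by_cases hq0 : normInv cj Fd G C_U ε x m q = 0
      · rw [if_pos hq0]
        have h0 : gpyMeasure cj Fd G C_U ε x m q (p₀ % q) = 0 := by
          unfold gpyMeasure; rw [hq0, div_zero]
        rw [h0]; positivity
      · rw [if_neg hq0]
    -- (2) the exceptional set lies in the two end ranges `p ≤ H x`, `p ≥ U/m − H x`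
    set Hr : ℝ := (hSum k x : ℝ) * x with hHr
    have hsub : (Rm C_U ε x m).filter (fun p => ∑ q ∈ intervalPrimes A' B,
          (if normInv cj Fd G C_U ε x m q = 0 then 1 / (q : ℝ)
            else gpyMeasure cj Fd G C_U ε x m q (p % q)) < t) ⊆
        (Rm C_U ε x m).filter (fun p : ℕ => (p : ℝ) ≤ Hr) ∪
          (Rm C_U ε x m).filter (fun p : ℕ => ¬ ((p : ℝ) < U C_U ε x / m - Hr)) := by
      intro p hp
      rw [Finset.mem_filter] at hp
      rw [Finset.mem_union]
      by_cases h1 : (p : ℝ) ≤ Hr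
      · exact Or.inl (Finset.mem_filter.2 ⟨hp.1, h1⟩)
      · by_cases h2 : (p : ℝ) < U C_U ε x / m - Hr
        · exfalso
          have hends : ∀ i : Fin k, (hTuple k x i : ℝ) * x < p ∧
              (p : ℝ) < U C_U ε x / m - hTuple k x i * x := by
            intro i
            have hi : (hTuple k x i : ℝ) * x ≤ Hr := by
              rw [hHr]
              exact mul_le_mul_of_nonneg_right (by exact_mod_cast hTuple_le_hSum k x i) hx0.le
            constructor
            · linarith only [not_le.1 h1, hi]
            · linarith only [h2, hi]
          exact absurd (hgood p hp.1 hends) (not_le.2 hp.2)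
        · exact Or.inr (Finset.mem_filter.2 ⟨hp.1, h2⟩)
    -- (3) sizes: `1 ≤ H ≤ A (log₃ x)³`, so `64 H ≤ η log₂ x`, `8 H ≤ log₂ x`
    have hH1 : (1 : ℝ) ≤ hSum k x := by exact_mod_cast one_le_hSum (by omega : 1 ≤ k) x
    have hH0 : (0 : ℝ) ≤ hSum k x := Nat.cast_nonneg _
    have hHr0 : 0 ≤ Hr := by rw [hHr]; positivity
    have hHr1 : 1 ≤ Hr := by rw [hHr]; exact one_le_mul_of_one_le_of_one_le hH1 hx1'
    have hHA : (hSum k x : ℝ) ≤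
        ((∑ i : Fin k, Nat.nth Nat.Prime (Nat.primeCounting k + i) : ℕ) : ℝ) *
          Real.log (Real.log (Real.log x)) ^ 3 := by
      rw [hSum_eq, Nat.cast_mul]
      exact mul_le_mul_of_nonneg_left (Pw_le hL₃) (Nat.cast_nonneg _)
    have hHL₂ : (64 / η + 8) * (hSum k x : ℝ) ≤ Real.log (Real.log x) := by
      refine le_trans (mul_le_mul_of_nonneg_left hHA (by positivity)) ?_
      rw [← mul_assoc]; exact hAL
    have hH64 : 64 * (hSum k x : ℝ) ≤ η * Real.log (Real.log x) := by
      have h1 : 64 / η * (hSum k x : ℝ) ≤ Real.log (Real.log x) := by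
        have h5 : (64 / η + 8) * (hSum k x : ℝ) = 64 / η * hSum k x + 8 * hSum k x := by ring
        linarith only [hHL₂, h5, mul_nonneg (show (0:ℝ) ≤ 8 by norm_num) hH0]
      have h2 := mul_le_mul_of_nonneg_left h1 hη.le
      have h3 : η * (64 / η * (hSum k x : ℝ)) = 64 * hSum k x := by field_simp
      linarith only [h2, h3]
    have hH8 : 8 * (hSum k x : ℝ) ≤ Real.log (Real.log x) := by
      have h5 : (64 / η + 8) * (hSum k x : ℝ) = 64 / η * hSum k x + 8 * hSum k x := by ring
      have h6 : 0 ≤ 64 / η * (hSum k x : ℝ) := by positivity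
      linarith only [hHL₂, h5, h6]
    -- (4) the parameters: `z ≤ x/2`, `U/m ≥ x log₂ x`, `U ≤ x (log x)²`, `m ≤ x`
    have hz0 : 0 < z x := by unfold z; positivity
    have hzle : z x ≤ (x : ℝ) / 2 := by
      unfold z; exact div_le_div_of_nonneg_left hx0.le (by norm_num) hL₂
    have hzL₂ : z x * Real.log (Real.log x) ^ 2 = (x : ℝ) * Real.log (Real.log x) := by
      unfold z; field_simp
    have hUm : (x : ℝ) * Real.log (Real.log x) ≤ U C_U ε x / m := by
      have hzl : 0 < z x * Real.log (Real.log x) ^ 2 := by positivity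
      have h1 := (lt_div_iff₀ hzl).1 hmU
      rw [hzL₂] at h1
      rw [le_div_iff₀ hm0]
      have h2 : (x : ℝ) * Real.log (Real.log x) * m = m * (x * Real.log (Real.log x)) := by ring
      linarith only [h1, h2]
    have hlogy : Real.log (y ε x) ≤ Real.log x := by
      rw [log_y]
      have h1 : Real.log (Real.log (Real.log (x : ℝ))) / Real.log (Real.log x) ≤ 1 := by
        rw [div_le_one hL₂0]; exact hL₃₂
      have h3 : (1 - ε) * (Real.log x * Real.log (Real.log (Real.log (x : ℝ))) /
          Real.log (Real.log x)) = (1 - ε) * Real.log x *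
            (Real.log (Real.log (Real.log (x : ℝ))) / Real.log (Real.log x)) := by ring
      rw [h3]
      have h4 : 0 ≤ (1 - ε) * Real.log x := by
        have : 0 ≤ 1 - ε := by linarith [hεb.2]
        positivity
      calc (1 - ε) * Real.log x * (Real.log (Real.log (Real.log (x : ℝ))) / Real.log (Real.log x))
          ≤ (1 - ε) * Real.log x * 1 := mul_le_mul_of_nonneg_left h1 h4
        _ ≤ Real.log x := by
            have h5 : 0 ≤ ε * Real.log x := mul_nonneg hεb.1.le hL0.le
            linarith only [h5]
    have hlogy0 : 0 < Real.log (y ε x) := by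
      rw [log_y]
      have : 0 < 1 - ε := by linarith [hεb.2]
      positivity
    have hU' : U C_U ε x ≤ C_U * ((x : ℝ) * Real.log x / Real.log (Real.log x)) := by
      unfold U
      apply mul_le_mul_of_nonneg_left _ hC.le
      exact div_le_div_of_nonneg_right (mul_le_mul_of_nonneg_left hlogy hx0.le) hL₂0.le
    have hxL0 : 0 ≤ (x : ℝ) * Real.log x := mul_nonneg hx0.le hL0.le
    have hU'' : U C_U ε x ≤ C_U * ((x : ℝ) * Real.log x) :=
      hU'.trans (mul_le_mul_of_nonneg_left (div_le_self hxL0 (by linarith only [hL₂])) hC.le)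
    have hU0 : 0 ≤ U C_U ε x := by
      unfold U
      exact mul_nonneg hC.le (div_nonneg (mul_nonneg hx0.le hlogy0.le) hL₂0.le)
    have hUle : U C_U ε x ≤ (x : ℝ) * Real.log x ^ 2 := by
      have h2 : C_U * ((x : ℝ) * Real.log x) ≤ Real.log x * ((x : ℝ) * Real.log x) :=
        mul_le_mul_of_nonneg_right hCU hxL0
      have h3 : Real.log x * ((x : ℝ) * Real.log x) = x * Real.log x ^ 2 := by ring
      linarith only [hU'', h2, h3]
    have hUmle : U C_U ε x / m ≤ (x : ℝ) * Real.log x ^ 2 :=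
      (div_le_self hU0 (by exact_mod_cast hm1)).trans hUle
    have hmx : m ≤ x := by
      have hzl : 0 < z x * Real.log (Real.log x) ^ 2 := by positivity
      have h2 : U C_U ε x / (z x * Real.log (Real.log x) ^ 2) ≤ x := by
        rw [div_le_iff₀ hzl, hzL₂]
        have h4 : C_U * ((x : ℝ) * Real.log x) = x * (C_U * Real.log x) := by ring
        have h5 : (x : ℝ) * (C_U * Real.log x) ≤ x * x := mul_le_mul_of_nonneg_left hCUL hx0.le
        have h6 : (x : ℝ) * x ≤ x * (x * Real.log (Real.log x)) :=
          mul_le_mul_of_nonneg_left (le_mul_of_one_le_right hx0.le (by linarith only [hL₂])) hx0.le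
        linarith only [hU'', h4, h5, h6]
      have h7 : (m : ℝ) ≤ x := (hmU.le).trans h2
      exact_mod_cast h7
    -- (5) Lemma 3 at `V = H x`, `V = U/m`, `V = U/m − H x − 1`
    set Sg := singProd ε x m with hSg
    have hSg0 : 0 ≤ Sg := by
      rw [hSg]; unfold singProd
      refine Finset.prod_nonneg fun p hp => ?_
      have hp2 : 2 ≤ p := (Finset.mem_filter.1 hp).2.1.two_le
      have : (2 : ℝ) ≤ p := by exact_mod_cast hp2
      exact div_nonneg (by linarith) (by linarith)
    set Ke := K * Real.exp (-(Real.log (Real.log x)) ^ ((1 : ℝ) / 2)) with hKe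
    have hKe0 : 0 ≤ Ke := by rw [hKe]; positivity
    have hKe_le : ∀ θ : ℝ, 0 < θ → (Real.log (θ / K)) ^ 2 ≤ Real.log (Real.log x) → Ke ≤ θ := by
      intro θ hθ hθ2
      rw [hKe]
      have h1 : -(Real.log (Real.log x) ^ ((1 : ℝ) / 2)) ≤ Real.log (θ / K) := by
        have h2 : |Real.log (θ / K)| ≤ Real.log (Real.log x) ^ ((1 : ℝ) / 2) := by
          rw [← Real.sqrt_eq_rpow, ← Real.sqrt_sq_eq_abs]
          exact Real.sqrt_le_sqrt hθ2
        linarith only [h2, neg_abs_le (Real.log (θ / K))]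
      calc K * Real.exp (-(Real.log (Real.log x) ^ ((1 : ℝ) / 2)))
          ≤ K * Real.exp (Real.log (θ / K)) :=
            mul_le_mul_of_nonneg_left (Real.exp_le_exp.2 h1) hK.le
        _ = θ := by rw [Real.exp_log (by positivity)]; field_simp
    have hKeη : Ke ≤ η / 8 := by
      refine hKe_le (η / 8) (by positivity) ?_
      rw [show η / 8 / K = η / (8 * K) by rw [div_div]]
      exact hc₁
    have hKe1 : Ke ≤ 1 / 2 := by
      refine hKe_le (1 / 2) (by norm_num) ?_
      rw [show (1 : ℝ) / 2 / K = 1 / (2 * K) by rw [div_div]]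
      exact hc₂
    have h3V : ∀ V : ℝ, z x + z x / Real.log x ≤ V → V ≤ (x : ℝ) * Real.log x ^ 2 →
        |((sievedPrimes ε x V m).card : ℝ) - (V - z x) / Real.log x * Sg| ≤
          Ke * ((V - z x) / Real.log x * Sg) := fun V hV1 hV2 => h3 V hV1 hV2 m hm1 hmx
    have hzdiv0 : 0 ≤ z x / Real.log x := div_nonneg hz0.le hL0.le
    have hzL : z x + z x / Real.log x ≤ (x : ℝ) := by
      have h1 : z x / Real.log x ≤ z x := div_le_self hz0.le (by linarith only [hL])
      linarith only [h1, hzle, hx0]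
    have hxH : (x : ℝ) ≤ Hr := by rw [hHr]; exact le_mul_of_one_le_left hx0.le hH1
    have hV₁lo : z x + z x / Real.log x ≤ Hr := by linarith only [hzL, hxH]
    have hL₂L : Real.log (Real.log x) ≤ Real.log x := by
      have h1 := Real.log_le_sub_one_of_pos hL0; linarith only [h1]
    have hV₁hi : Hr ≤ (x : ℝ) * Real.log x ^ 2 := by
      rw [hHr, mul_comm]
      apply mul_le_mul_of_nonneg_left _ hx0.le
      have h1 : (hSum k x : ℝ) ≤ Real.log x := by linarith only [hH8, hL₂L, hH0]
      have h2 : Real.log x ≤ Real.log x ^ 2 := by nlinarith only [hL]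
      exact h1.trans h2
    have hV₂lo : z x + z x / Real.log x ≤ U C_U ε x / m - Hr - 1 := by
      have h1 : Hr + 1 + (x : ℝ) ≤ (x : ℝ) * Real.log (Real.log x) := by
        rw [hHr]
        have h2 : ((hSum k x : ℝ) + 2) * x ≤ Real.log (Real.log x) * x :=
          mul_le_mul_of_nonneg_right (by linarith only [hH8, hH1]) hx0.le
        have h3 : ((hSum k x : ℝ) + 2) * x = hSum k x * x + 2 * x := by ring
        have h4 : Real.log (Real.log x) * x = x * Real.log (Real.log x) := by ring
        linarith only [h2, h3, h4, hx1']
      linarith only [h1, hzL, hUm]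
    have hV₀lo : z x + z x / Real.log x ≤ U C_U ε x / m := by linarith only [hV₂lo, hHr0]
    have hV₂hi : U C_U ε x / m - Hr - 1 ≤ (x : ℝ) * Real.log x ^ 2 := by
      linarith only [hUmle, hHr0]
    have h3H := h3V Hr hV₁lo hV₁hi
    have h3U := h3V (U C_U ε x / m) hV₀lo hUmle
    have h3W := h3V (U C_U ε x / m - Hr - 1) hV₂lo hV₂hi
    -- (6) set inclusions
    have hS1 : (Rm C_U ε x m).filter (fun p : ℕ => (p : ℝ) ≤ Hr) ⊆ sievedPrimes ε x Hr m := by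
      intro p hp
      simp only [Rm, sievedPrimes, Finset.mem_filter, Finset.mem_Icc] at hp ⊢
      exact ⟨⟨hp.1.1.1, Nat.le_floor hp.2⟩, hp.1.2⟩
    have hS2 : sievedPrimes ε x (U C_U ε x / m - Hr - 1) m ⊆
        (Rm C_U ε x m).filter (fun p : ℕ => (p : ℝ) < U C_U ε x / m - Hr) := by
      intro p hp
      simp only [Rm, sievedPrimes, Finset.mem_filter, Finset.mem_Icc] at hp ⊢
      have hV0 : 0 ≤ U C_U ε x / m - Hr - 1 :=
        le_trans (by linarith only [hzdiv0, hz0]) hV₂lo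
      have hpV : (p : ℝ) ≤ U C_U ε x / m - Hr - 1 :=
        le_trans (by exact_mod_cast hp.1.2) (Nat.floor_le hV0)
      refine ⟨⟨⟨hp.1.1, Nat.le_floor ?_⟩, hp.2⟩, by linarith only [hpV]⟩
      linarith only [hpV, hHr0]
    -- (7) cardinalities
    have hcard_f2 : (((Rm C_U ε x m).filter (fun p : ℕ => ¬ ((p : ℝ) < U C_U ε x / m - Hr))).card : ℝ)
        = (Rm C_U ε x m).card -
          ((Rm C_U ε x m).filter (fun p : ℕ => (p : ℝ) < U C_U ε x / m - Hr)).card := by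
      have h := Finset.card_filter_add_card_filter_not (s := Rm C_U ε x m)
        (fun p : ℕ => (p : ℝ) < U C_U ε x / m - Hr)
      have h' : (((Rm C_U ε x m).filter (fun p : ℕ => (p : ℝ) < U C_U ε x / m - Hr)).card : ℝ) +
          (((Rm C_U ε x m).filter (fun p : ℕ => ¬ ((p : ℝ) < U C_U ε x / m - Hr))).card : ℝ) =
            (Rm C_U ε x m).card := by exact_mod_cast h
      linarith only [h']
    have hRR : Rm C_U ε x m = sievedPrimes ε x (U C_U ε x / m) m := rfl
    have hcH : (((Rm C_U ε x m).filter (fun p : ℕ => (p : ℝ) ≤ Hr)).card : ℝ) ≤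
        (1 + Ke) * ((Hr - z x) / Real.log x * Sg) := by
      have h1 : (((Rm C_U ε x m).filter (fun p : ℕ => (p : ℝ) ≤ Hr)).card : ℝ) ≤
          (sievedPrimes ε x Hr m).card := by exact_mod_cast Finset.card_le_card hS1
      have h2 := (abs_le.1 h3H).2
      linarith only [h1, h2]
    have hcRu : ((Rm C_U ε x m).card : ℝ) ≤ (1 + Ke) * ((U C_U ε x / m - z x) / Real.log x * Sg) := by
      have h2 := (abs_le.1 h3U).2
      rw [hRR]; linarith only [h2]
    have hcRl : (1 - Ke) * ((U C_U ε x / m - z x) / Real.log x * Sg) ≤ (Rm C_U ε x m).card := by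
      have h2 := (abs_le.1 h3U).1
      rw [hRR]; linarith only [h2]
    have hcV : (1 - Ke) * ((U C_U ε x / m - Hr - 1 - z x) / Real.log x * Sg) ≤
        ((Rm C_U ε x m).filter (fun p : ℕ => (p : ℝ) < U C_U ε x / m - Hr)).card := by
      have h1 : ((sievedPrimes ε x (U C_U ε x / m - Hr - 1) m).card : ℝ) ≤
          ((Rm C_U ε x m).filter (fun p : ℕ => (p : ℝ) < U C_U ε x / m - Hr)).card := by
        exact_mod_cast Finset.card_le_card hS2
      have h2 := (abs_le.1 h3W).1
      linarith only [h1, h2]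
    -- (8) the numeric conclusion
    have hW0 : 0 ≤ Sg / Real.log x := div_nonneg hSg0 hL0.le
    have ha0 : 0 ≤ U C_U ε x / m - z x := by
      linarith only [hV₀lo, hzdiv0]
    have hba : 3 * Hr + 1 ≤ η / 4 * (U C_U ε x / m - z x) := by
      have h1 : (x : ℝ) * Real.log (Real.log x) / 2 ≤ U C_U ε x / m - z x := by
        have h5 : (x : ℝ) ≤ (x : ℝ) * Real.log (Real.log x) :=
          le_mul_of_one_le_right hx0.le (by linarith only [hL₂])
        linarith only [hzle, h5, hUm]
      have h2 : 64 * Hr ≤ η * Real.log (Real.log x) * x := by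
        rw [hHr]
        have h5 := mul_le_mul_of_nonneg_right hH64 hx0.le
        have h6 : 64 * ((hSum k x : ℝ) * x) = 64 * (hSum k x : ℝ) * x := by ring
        linarith only [h5, h6]
      have h3 := mul_le_mul_of_nonneg_left h1 (by positivity : 0 ≤ η / 4)
      have h4 : η / 4 * ((x : ℝ) * Real.log (Real.log x) / 2) = η * Real.log (Real.log x) * x / 8 := by
        ring
      linarith only [h2, h3, h4, hHr1]
    have key := endRange_numeric (W := Sg / Real.log x) (a := U C_U ε x / m - z x) (b := Hr)
      (zr := z x)
      (cH := (((Rm C_U ε x m).filter (fun p : ℕ => (p : ℝ) ≤ Hr)).card : ℝ))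
      (cR := ((Rm C_U ε x m).card : ℝ))
      (cV := (((Rm C_U ε x m).filter (fun p : ℕ => (p : ℝ) < U C_U ε x / m - Hr)).card : ℝ))
      hW0 ha0 hHr0 hz0.le hKe0 hKe1 (by linarith only [hKeη]) hη hba
      (by rw [show (Hr - z x) * (Sg / Real.log x) = (Hr - z x) / Real.log x * Sg by ring]
          exact hcH)
      (by rw [show (U C_U ε x / m - z x) * (Sg / Real.log x) =
            (U C_U ε x / m - z x) / Real.log x * Sg by ring]
          exact hcRu)
      (by rw [show (U C_U ε x / m - z x) * (Sg / Real.log x) =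
            (U C_U ε x / m - z x) / Real.log x * Sg by ring]
          exact hcRl)
      (by rw [show (U C_U ε x / m - z x - Hr - 1) * (Sg / Real.log x) =
            (U C_U ε x / m - Hr - 1 - z x) / Real.log x * Sg by ring]
          exact hcV)
    calc ((((Rm C_U ε x m).filter (fun p => ∑ q ∈ intervalPrimes A' B,
            (if normInv cj Fd G C_U ε x m q = 0 then 1 / (q : ℝ)
              else gpyMeasure cj Fd G C_U ε x m q (p % q)) < t)).card : ℝ))
        ≤ (((Rm C_U ε x m).filter (fun p : ℕ => (p : ℝ) ≤ Hr) ∪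
            (Rm C_U ε x m).filter (fun p : ℕ => ¬ ((p : ℝ) < U C_U ε x / m - Hr))).card : ℝ) := by
          exact_mod_cast Finset.card_le_card hsub
      _ ≤ (((Rm C_U ε x m).filter (fun p : ℕ => (p : ℝ) ≤ Hr)).card : ℝ) +
            (((Rm C_U ε x m).filter (fun p : ℕ => ¬ ((p : ℝ) < U C_U ε x / m - Hr))).card : ℝ) := by
          exact_mod_cast Finset.card_union_le _ _
      _ = (((Rm C_U ε x m).filter (fun p : ℕ => (p : ℝ) ≤ Hr)).card : ℝ) +
            (((Rm C_U ε x m).card : ℝ) -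
              ((Rm C_U ε x m).filter (fun p : ℕ => (p : ℝ) < U C_U ε x / m - Hr)).card) := by
          rw [hcard_f2]
      _ ≤ η * (Rm C_U ε x m).card := key

/-- **Maynard's Theorem 1 from the two remaining named facts** (Lemmas 7 and 8 of this file):
Lemmas 2, 3, 4, the reduction of §2, §3 and the assembly above are all proved in the tree.
[cite: Maynard2016LargeGaps, Theorem 1] -/
theorem theorem1_of_lemma7_lemma8 (h7 : Lemma7) (h8 : Lemma8) :
    Literature.NumberTheory.Sieve.Maynard2016_theorem1 :=
  theorem1_of_GPYMeasures_holds (gpyMeasures_of_lemma7_lemma8 h7 h8)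

/-- **`∀ c, RankinConstant c` from Lemmas 7 and 8.** [cite: Maynard2016LargeGaps, Theorem 1] -/
theorem forall_rankinConstant_of_lemma7_lemma8 (h7 : Lemma7) (h8 : Lemma8) (c : ℝ) :
    Literature.NumberTheory.Sieve.RankinConstant c :=
  forall_rankinConstant_of_GPYMeasures_holds (gpyMeasures_of_lemma7_lemma8 h7 h8) c


end Maynard2016

end Literature.NumberTheory.Sieve
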